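import Literature.AnabelianGeometry.EtaleTheta.TowerOfSetting
import HarnessLib

/-!
# [EtTh] §2 over §1: the compatible cyclotome identifications `μ_M ≅ (l·Δ_Θ) ⊗ ℤ/Mℤ` at EVERY level
# `M ∈ ℕ≥1`, from a `CyclotomeTower` over a cofinal chain (support lemma for [IUTchII] Prop. 1.5)

Mochizuki, *The étale theta function …*, Publ. RIMS **45** (2009), §2, Cor. 2.19 (ii), PRIMS PDF p. 64
(printed 290): "Let `E ⊆ ℕ≥1` be a cofinal, totally ordered subset of `ℕ≥1` … such that `1 ∈ E`. Thus, by
letting the integer `N` vary in `E`, we obtain a natural projective system …" [cite: MochizukiEtTh2009, Cor 2.19 (ii) p.64];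
and Def. 2.13 (ii), p. 48: "`M_{N'}`, the mod `N'` mono-theta environment induced by `M`"
[cite: MochizukiEtTh2009, Def 2.13 (ii) p.48]. Layer L2 vocabulary of the abc-iut cell (seat
abc-iut-L2-t8's `TowerOfSetting.lean`: `CyclotomeTower l E` = one `CyclotomeMod l M` per level `M ∈ E`,
compatible with the REAL power maps `MuN.red : μ_{M'} ↠ μ_M`).

PURPOSE (abc-iut GAP-LEDGER row G-w4d030-1, [IUTchII] Prop. 1.5 (i), kurims p. 29: "the index `M` of
the projective system varies multiplicatively among the elements of `ℕ≥1`", whereas the cited [EtTh]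
Cor. 2.19 (ii) is indexed by a cofinal CHAIN `E`): this file supplies, from a `CyclotomeTower` over a
cofinal chain `E ∋ 1`, the cyclotome identification at EVERY level `M ∈ ℕ≥1` and proves that these are
compatible for EVERY divisibility `M ∣ M'` in `ℕ≥1` (not only along the chain). Construction: for each
`M` choose (by cofinality) a level `e(M) ∈ E` divisible by `M` and put
`(l·Δ_Θ) ↠ μ_{e(M)} ↠ μ_M`; independence of the choice and the all-pairs compatibility follow from
`E` being totally ordered + the tower's own compatibility + transitivity of the power maps. The one
group-theoretic input is `MuN.red_eq_one_iff` — in the cyclic group `μ_{M'}` the kernel of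
`ζ ↦ ζ^{M'/M}` is exactly the subgroup of `M`-th powers — used to compute the kernel of the composite
(`Δ_Θ` is commutative, `Setting.ker_thetaToEll_comm`). Consequence for the §2 data over §1
(`ThetaEnvOfSetting.lean`): `C.thetaEnvData (τ.modAll M) hC hS` is available at every `M ∈ ℕ≥1`, and
the mod-`M` theta cocycles are the reductions of the mod-`M'` ones for every `M ∣ M'`
(`red_comp_modN_all`, `thetaCocycles_red_mem_all`, `thetaCocycles_red_surj_all`).

PROOF-ONLY w.r.t. the landed L2 files (nothing there is edited or restated); new declarations are
definitions/lemmas over landed vocabulary, no named fact. HONEST FRAMING: [EtTh] is refereed; nothing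
disputed is asserted; no side is taken on [IUTchIII] Cor. 3.12; typed ≠ discharged.
-/

noncomputable section

namespace Literature.AnabelianGeometry.EtaleTheta

open Literature.AnabelianGeometry.SemiGraphs

variable (p : ℕ) [Fact p.Prime]

/-! ### Group theory of `μ_{M'} ↠ μ_M`: the kernel of the power map is the subgroup of `M`-th powers -/

/-- Every element of `μ_M` is killed by `M`. [cite: MochizukiEtTh2009, Def 2.10 p.44] -/
theorem MuN.pow_card_eq_one (M : ℕ+) (ζ : MuN p M) : ζ ^ (M : ℕ) = 1 := by
  apply Subtype.ext
  have h := ζ.2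
  rw [mem_rootsOfUnity] at h
  simpa using h

/-- An `M`-th power in `μ_{M'}` reduces to `1` in `μ_M` (`(ξ^M)^{M'/M} = ξ^{M'} = 1`).
[cite: MochizukiEtTh2009, Def 2.13 (ii) p.48] -/
theorem MuN.red_pow_card (M M' : ℕ+) (h : (M : ℕ) ∣ M') (ξ : MuN p M') :
    MuN.red p M M' h (ξ ^ (M : ℕ)) = 1 := by
  rw [map_pow]
  exact MuN.pow_card_eq_one p M _

/-- **In the cyclic group `μ_{M'}` the kernel of `ζ ↦ ζ^{M'/M}` (`μ_{M'} ↠ μ_M`) is the subgroup of `M`-th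
powers.** [cite: MochizukiEtTh2009, Def 2.13 (ii) p.48] -/
theorem MuN.red_eq_one_iff (M M' : ℕ+) (h : (M : ℕ) ∣ M') (ζ : MuN p M') :
    MuN.red p M M' h ζ = 1 ↔ ∃ ξ : MuN p M', ζ = ξ ^ (M : ℕ) := by
  constructor
  · intro hζ
    obtain ⟨ω, hω⟩ := HasEnoughRootsOfUnity.exists_primitiveRoot (PadicAlgCl p) M'
    have hωu := hω.isUnit_unit M'.ne_zero
    set ωu := (hω.isUnit M'.ne_zero).unit
    have hmem : ωu ∈ rootsOfUnity M' (PadicAlgCl p) := by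
      rw [mem_rootsOfUnity]; exact hωu.pow_eq_one
    -- `ζ = ω^i`
    have hz : (ζ : (PadicAlgCl p)ˣ) ∈ Subgroup.zpowers ωu := by
      rw [hωu.zpowers_eq]; exact ζ.2
    obtain ⟨i, hi⟩ := Subgroup.mem_zpowers_iff.1 hz
    -- `ζ^{M'/M} = 1` in `μ_M`, i.e. `ω^{i·(M'/M)} = 1`, so `M' ∣ i·(M'/M)`, so `M ∣ i`
    have h1 : ((ζ : (PadicAlgCl p)ˣ)) ^ ((M' : ℕ) / M) = 1 := by
      have := congrArg (fun x : MuN p M => ((x : (PadicAlgCl p)ˣ))) hζ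
      simpa [MuN.coe_red] using this
    rw [← hi, ← zpow_natCast, ← zpow_mul] at h1
    have hdvd : ((M' : ℕ) : ℤ) ∣ i * (((M' : ℕ) / M : ℕ) : ℤ) := (hωu.zpow_eq_one_iff_dvd _).1 h1
    obtain ⟨q, hq⟩ := h
    have hM'pos : (0 : ℤ) < ((M' : ℕ) / M : ℕ) := by
      have : 0 < (M' : ℕ) / M := Nat.div_pos (Nat.le_of_dvd M'.pos ⟨q, hq⟩) M.pos
      exact_mod_cast this
    have hdvdM : ((M : ℕ) : ℤ) ∣ i := by
      have hM' : ((M' : ℕ) : ℤ) = ((M : ℕ) : ℤ) * (((M' : ℕ) / M : ℕ) : ℤ) := by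
        have : (M' : ℕ) = M * ((M' : ℕ) / M) := by
          rw [hq, Nat.mul_div_cancel_left q M.pos]
        exact_mod_cast this
      rw [hM'] at hdvd
      exact (mul_dvd_mul_iff_right hM'pos.ne').1 hdvd
    obtain ⟨j, hj⟩ := hdvdM
    refine ⟨⟨ωu ^ j, Subgroup.zpow_mem _ hmem j⟩, Subtype.ext ?_⟩
    change (ζ : (PadicAlgCl p)ˣ) = (ωu ^ j) ^ (M : ℕ)
    rw [← hi, hj, zpow_mul', zpow_natCast]
  · rintro ⟨ξ, rfl⟩
    exact MuN.red_pow_card p M M' h ξ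

namespace ThetaSetting

namespace CyclotomeTower

variable {p} {D : ThetaSetting p} {l : ℕ} {Es : Set ℕ+} (τ : D.CyclotomeTower l Es)

/-! ### A chosen level of the chain above each `M ∈ ℕ≥1` -/

/-- A chosen level `e(M) ∈ E` divisible by `M` ("`E` is cofinal in `ℕ≥1`", Cor. 2.19 (ii)).
[cite: MochizukiEtTh2009, Cor 2.19 (ii) p.64] -/
def lift (M : ℕ+) : Es :=
  ⟨Classical.choose (τ.cofinal M), (Classical.choose_spec (τ.cofinal M)).1⟩

/-- `M ∣ e(M)`. [cite: MochizukiEtTh2009, Cor 2.19 (ii) p.64] -/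
theorem dvd_lift (M : ℕ+) : (M : ℕ) ∣ ((τ.lift M : ℕ+) : ℕ) :=
  PNat.dvd_iff.1 (Classical.choose_spec (τ.cofinal M)).2

/-- The composite `(l·Δ_Θ) ↠ μ_e ↠ μ_M` through a level `e ∈ E` with `M ∣ e`.
[cite: MochizukiEtTh2009, Def 2.13 (ii) p.48] -/
def redVia (M : ℕ+) (e : Es) (h : (M : ℕ) ∣ ((e : ℕ+) : ℕ)) : D.lDeltaTheta l →* MuN p M :=
  (MuN.red p M e h).comp (τ.mod e).red

/-- `redVia` on elements. [cite: MochizukiEtTh2009, Def 2.13 (ii) p.48] -/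
theorem redVia_apply (M : ℕ+) (e : Es) (h : (M : ℕ) ∣ ((e : ℕ+) : ℕ)) (x : D.lDeltaTheta l) :
    τ.redVia M e h x = MuN.red p M e h ((τ.mod e).red x) := rfl

/-- **Independence of the level**: the composite `(l·Δ_Θ) ↠ μ_e ↠ μ_M` does not depend on the choice of
the level `e ∈ E` above `M` (`E` totally ordered + compatibility of the tower + transitivity of the power
maps). [cite: MochizukiEtTh2009, Cor 2.19 (ii) p.64] -/
theorem redVia_eq_redVia (M : ℕ+) (e e' : Es) (h : (M : ℕ) ∣ ((e : ℕ+) : ℕ))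
    (h' : (M : ℕ) ∣ ((e' : ℕ+) : ℕ)) (x : D.lDeltaTheta l) :
    τ.redVia M e h x = τ.redVia M e' h' x := by
  rw [redVia_apply, redVia_apply]
  rcases τ.total e e.2 e' e'.2 with hee' | he'e
  · -- `e ∣ e'`: `mod_e = red_{e,e'} ∘ mod_{e'}`
    have hn : ((e : ℕ+) : ℕ) ∣ ((e' : ℕ+) : ℕ) := PNat.dvd_iff.1 hee'
    rw [← τ.red_mod e e' hn x, ← MuN.red_comp p M e e' h hn]
  · have hn : ((e' : ℕ+) : ℕ) ∣ ((e : ℕ+) : ℕ) := PNat.dvd_iff.1 he'e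
    rw [← τ.red_mod e' e hn x, ← MuN.red_comp p M e' e h' hn]

/-! ### The identification at every level `M ∈ ℕ≥1` -/

/-- Conjugation-equivariance of the composite through a level (from `red_conj` of the tower's
identification and Galois-equivariance of the power maps). [cite: MochizukiEtTh2009, Def 2.13 (ii) p.48] -/
theorem redVia_conj (M : ℕ+) (e : Es) (h : (M : ℕ) ∣ ((e : ℕ+) : ℕ)) (σ : D.PiTemp)
    (x : D.lDeltaTheta l) :
    τ.redVia M e h ⟨D.toTheta σ * x * (D.toTheta σ)⁻¹, (D.lDeltaTheta_normal l).conj_mem _ x.2 _⟩ =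
      galMuN p M (D.aug.toMonoidHom σ) (τ.redVia M e h x) := by
  rw [redVia_apply, redVia_apply, (τ.mod e).red_conj, MuN.red_gal]

/-- Elements of `l·Δ_Θ` commute (`Δ_Θ` is commutative, [EtTh] §1 p. 12). [cite: MochizukiEtTh2009, §1 p.12] -/
theorem lDeltaTheta_commute (x y : D.lDeltaTheta l) : Commute x y := by
  have hx : (x : D.GtpTheta) ∈ D.DeltaTheta := D.lDeltaTheta_le l x.2
  have hy : (y : D.GtpTheta) ∈ D.DeltaTheta := D.lDeltaTheta_le l y.2
  have h : (x : D.GtpTheta) * y = y * x := D.ker_thetaToEll_comm _ hx _ hy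
  exact Subtype.ext h

/-- The kernel of the composite `(l·Δ_Θ) ↠ μ_e ↠ μ_M` is the subgroup of `M`-th powers (kernel of
`mod_e` = `e`-th powers, kernel of `μ_e ↠ μ_M` = `M`-th powers, `mod_e` onto, `l·Δ_Θ` commutative).
[cite: MochizukiEtTh2009, Def 2.13 (ii) p.48] -/
theorem redVia_eq_one_iff (M : ℕ+) (e : Es) (h : (M : ℕ) ∣ ((e : ℕ+) : ℕ)) (x : D.lDeltaTheta l) :
    τ.redVia M e h x = 1 ↔ ∃ y : D.lDeltaTheta l, x = y ^ (M : ℕ) := by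
  constructor
  · intro hx
    rw [redVia_apply, MuN.red_eq_one_iff] at hx
    obtain ⟨ξ, hξ⟩ := hx
    obtain ⟨y₀, hy₀⟩ := (τ.mod e).red_surjective ξ
    -- `mod_e (x * (y₀^M)⁻¹) = 1`, so `x * (y₀^M)⁻¹ = z^e`
    have h1 : (τ.mod e).red (x * (y₀ ^ (M : ℕ))⁻¹) = 1 := by
      rw [map_mul, map_inv, map_pow, hy₀, ← hξ, mul_inv_cancel]
    obtain ⟨z, hz⟩ := ((τ.mod e).red_ker _).1 h1
    obtain ⟨q, hq⟩ := h
    refine ⟨z ^ q * y₀, ?_⟩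
    have hcomm : Commute (z ^ q) y₀ := lDeltaTheta_commute _ _
    rw [hcomm.mul_pow, ← pow_mul, mul_comm q, ← hq, ← hz, inv_mul_cancel_right]
  · rintro ⟨y, rfl⟩
    rw [redVia_apply, map_pow]
    exact MuN.red_pow_card p M e h _

/-- **The identification `μ_M ≅ (l·Δ_Θ) ⊗ ℤ/Mℤ` at EVERY level `M ∈ ℕ≥1`** induced by a `CyclotomeTower`
over a cofinal chain `E ∋ 1`: `(l·Δ_Θ) ↠ μ_{e(M)} ↠ μ_M` through a chosen level `e(M) ∈ E` above `M`
(onto; kernel the `M`-th powers; continuous; `G_K`-equivariant — all PROVED).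
[cite: MochizukiEtTh2009, Def 2.13 (ii) p.48] -/
def modAll (M : ℕ+) : D.CyclotomeMod l M where
  red := τ.redVia M (τ.lift M) (τ.dvd_lift M)
  red_surjective :=
    (MuN.red_surjective p M (τ.lift M) (τ.dvd_lift M)).comp (τ.mod (τ.lift M)).red_surjective
  red_ker := τ.redVia_eq_one_iff M (τ.lift M) (τ.dvd_lift M)
  continuous_red :=
    (continuous_of_discreteTopology (f := ⇑(MuN.red p M (τ.lift M) (τ.dvd_lift M)))).comp
      (τ.mod (τ.lift M)).continuous_red
  red_conj := τ.redVia_conj M (τ.lift M) (τ.dvd_lift M)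

/-- The identification at level `M` IS the composite through the chosen level `e(M)` (definitional).
[cite: MochizukiEtTh2009, Cor 2.19 (ii) p.64] -/
theorem modAll_red (M : ℕ+) : (τ.modAll M).red = τ.redVia M (τ.lift M) (τ.dvd_lift M) := rfl

/-- `modAll M` computed through ANY level `e ∈ E` above `M`. [cite: MochizukiEtTh2009, Cor 2.19 (ii) p.64] -/
theorem modAll_red_eq_redVia (M : ℕ+) (e : Es) (h : (M : ℕ) ∣ ((e : ℕ+) : ℕ))
    (x : D.lDeltaTheta l) : (τ.modAll M).red x = τ.redVia M e h x := by
  rw [modAll_red]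
  exact τ.redVia_eq_redVia M (τ.lift M) e (τ.dvd_lift M) h x

/-- At a level `e ∈ E` of the chain itself, `modAll e` IS the tower's identification `τ.mod e`.
[cite: MochizukiEtTh2009, Cor 2.19 (ii) p.64] -/
theorem modAll_red_level (e : Es) (x : D.lDeltaTheta l) :
    (τ.modAll (e : ℕ+)).red x = (τ.mod e).red x := by
  rw [τ.modAll_red_eq_redVia (e : ℕ+) e (dvd_refl ((e : ℕ+) : ℕ)) x, redVia_apply, MuN.red_self]

/-- **Compatibility for EVERY divisibility `M ∣ M'` in `ℕ≥1`** (not only along the chain):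
`(l·Δ_Θ ↠ μ_{M'} ↠ μ_M) = (l·Δ_Θ ↠ μ_M)`. [cite: MochizukiEtTh2009, Cor 2.19 (ii) p.64] -/
theorem red_modAll (M M' : ℕ+) (h : (M : ℕ) ∣ (M' : ℕ)) (x : D.lDeltaTheta l) :
    MuN.red p M M' h ((τ.modAll M').red x) = (τ.modAll M).red x := by
  have hM'e : (M' : ℕ) ∣ ((τ.lift M' : ℕ+) : ℕ) := τ.dvd_lift M'
  have hMe : (M : ℕ) ∣ ((τ.lift M' : ℕ+) : ℕ) := h.trans hM'e
  rw [τ.modAll_red_eq_redVia M (τ.lift M') hMe x, modAll_red, redVia_apply, redVia_apply,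
    ← MuN.red_comp p M M' (τ.lift M') h hM'e]

/-! ### Re-chaining: a `CyclotomeTower` over ANY cofinal chain from all-level data -/

/-- **A `CyclotomeTower` over any cofinal chain `E' ∋ 1`** built from a family of identifications
`μ_M ≅ (l·Δ_Θ) ⊗ ℤ/Mℤ` at EVERY `M ∈ ℕ≥1` compatible for every `M ∣ M'` (e.g. `modAll`/`red_modAll`):
restrict the family to `E'`. (Lets a consumer run the chain-indexed [EtTh] §2 tower theorems along a chain
through any prescribed pair `M ∣ M'`.) [cite: MochizukiEtTh2009, Cor 2.19 (ii) p.64] -/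
def ofAllLevels (mods : ∀ M : ℕ+, D.CyclotomeMod l M)
    (hmods : ∀ (M M' : ℕ+) (h : (M : ℕ) ∣ (M' : ℕ)) (x : D.lDeltaTheta l),
      MuN.red p M M' h ((mods M').red x) = (mods M).red x)
    {E' : Set ℕ+} (one_mem : (1 : ℕ+) ∈ E') (cofinal : ∀ n : ℕ+, ∃ M ∈ E', n ∣ M)
    (total : ∀ M ∈ E', ∀ M' ∈ E', M ∣ M' ∨ M' ∣ M) : D.CyclotomeTower l E' where
  one_mem := one_mem
  cofinal := cofinal
  total := total
  mod M := mods M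
  red_mod M M' h x := hmods M M' h x

/-- The levels of `ofAllLevels` are the given identifications (definitional).
[cite: MochizukiEtTh2009, Cor 2.19 (ii) p.64] -/
@[simp] theorem ofAllLevels_mod (mods : ∀ M : ℕ+, D.CyclotomeMod l M)
    (hmods : ∀ (M M' : ℕ+) (h : (M : ℕ) ∣ (M' : ℕ)) (x : D.lDeltaTheta l),
      MuN.red p M M' h ((mods M').red x) = (mods M).red x)
    {E' : Set ℕ+} (one_mem : (1 : ℕ+) ∈ E') (cofinal : ∀ n : ℕ+, ∃ M ∈ E', n ∣ M)
    (total : ∀ M ∈ E', ∀ M' ∈ E', M ∣ M' ∨ M' ∣ M) (M : E') :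
    (ofAllLevels mods hmods one_mem cofinal total).mod M = mods M := rfl

/-- **Re-chaining a tower**: the tower `τ` over the chain `E` transported to ANY other cofinal chain
`E' ∋ 1`, through its all-level identifications `modAll`. [cite: MochizukiEtTh2009, Cor 2.19 (ii) p.64] -/
def rechain {E' : Set ℕ+} (one_mem : (1 : ℕ+) ∈ E') (cofinal : ∀ n : ℕ+, ∃ M ∈ E', n ∣ M)
    (total : ∀ M ∈ E', ∀ M' ∈ E', M ∣ M' ∨ M' ∣ M) : D.CyclotomeTower l E' :=
  ofAllLevels τ.modAll τ.red_modAll one_mem cofinal total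

/-- The levels of the re-chained tower are `modAll` (definitional). [cite: MochizukiEtTh2009, Cor 2.19 (ii) p.64] -/
@[simp] theorem rechain_mod {E' : Set ℕ+} (one_mem : (1 : ℕ+) ∈ E')
    (cofinal : ∀ n : ℕ+, ∃ M ∈ E', n ∣ M) (total : ∀ M ∈ E', ∀ M' ∈ E', M ∣ M' ∨ M' ∣ M) (M : E') :
    (τ.rechain one_mem cofinal total).mod M = τ.modAll M := rfl

/-- Re-chaining over the ORIGINAL chain `E` gives back the tower's identifications on elements
(`modAll e = τ.mod e` on `E`). [cite: MochizukiEtTh2009, Cor 2.19 (ii) p.64] -/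
theorem rechain_self_mod_red (e : Es) (x : D.lDeltaTheta l) :
    ((τ.rechain τ.one_mem τ.cofinal τ.total).mod e).red x = (τ.mod e).red x :=
  τ.modAll_red_level e x

end CyclotomeTower

/-! ### Consequence: the §2 model data of `X̲̲` at every level, cocycles compatible for every `M ∣ M'` -/

namespace EtaleThetaData.DoubleUnderline

variable {p} {D : ThetaSetting p} {E : D.EtaleThetaData} {l : ℕ} (C : E.DoubleUnderline l) {Es : Set ℕ+}
  (τ : D.CyclotomeTower l Es)

/-- The reduction of the mod-`M'` theta cocycle of a root cocycle is its mod-`M` theta cocycle, for EVERY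
`M ∣ M'` in `ℕ≥1` (the chain-indexed `red_comp_modN` of `TowerOfSetting`, now at all levels).
[cite: MochizukiEtTh2009, Cor 2.19 (ii) p.64] -/
theorem red_comp_modN_all {M M' : ℕ+} (h : (M : ℕ) ∣ (M' : ℕ))
    (f : contCocycles D.toTheta D.DeltaTheta C.GtpYdduu)
    (hf : ∀ g, (f.1 g : D.GtpTheta) ∈ D.lDeltaTheta l) :
    MuN.red p M M' h ∘ C.modN (τ.modAll M') f hf = C.modN (τ.modAll M) f hf := by
  funext g
  exact τ.red_modAll M M' h _

/-- "The mod-`M` cocycles are the reductions of the mod-`M'` cocycles", for every `M ∣ M'` in `ℕ≥1`.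
[cite: MochizukiEtTh2009, Cor 2.19 (ii) p.64] -/
theorem thetaCocycles_red_mem_all (hC : D.Compat) {M M' : ℕ+} (h : (M : ℕ) ∣ (M' : ℕ))
    {η : D.GtpYdd.subgroupOf C.Huu → MuN p M'} (hη : η ∈ C.thetaCocycles hC (τ.modAll M')) :
    MuN.red p M M' h ∘ η ∈ C.thetaCocycles hC (τ.modAll M) := by
  obtain ⟨f, hf, rfl⟩ := hη
  exact ⟨f, hf, C.red_comp_modN_all τ h f hf.1⟩

/-- "… all of them": every mod-`M` cocycle is the reduction of a mod-`M'` cocycle, for every `M ∣ M'` in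
`ℕ≥1`. [cite: MochizukiEtTh2009, Cor 2.19 (ii) p.64] -/
theorem thetaCocycles_red_surj_all (hC : D.Compat) {M M' : ℕ+} (h : (M : ℕ) ∣ (M' : ℕ))
    {η : D.GtpYdd.subgroupOf C.Huu → MuN p M} (hη : η ∈ C.thetaCocycles hC (τ.modAll M)) :
    ∃ η' ∈ C.thetaCocycles hC (τ.modAll M'), MuN.red p M M' h ∘ η' = η := by
  obtain ⟨f, hf, rfl⟩ := hη
  exact ⟨C.modN (τ.modAll M') f hf.1, ⟨f, hf, rfl⟩, C.red_comp_modN_all τ h f hf.1⟩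

/-- The level-`M` model data of `X̲̲` at EVERY `M ∈ ℕ≥1` is `C.thetaEnvData (τ.modAll M) hC hS`; at a level
`e ∈ E` its cocycles are those of the chain-indexed tower of `TowerOfSetting` (same identification).
[cite: MochizukiEtTh2009, Cor 2.19 (ii) p.64] -/
theorem modN_modAll_level (e : Es) (f : contCocycles D.toTheta D.DeltaTheta C.GtpYdduu)
    (hf : ∀ g, (f.1 g : D.GtpTheta) ∈ D.lDeltaTheta l) :
    C.modN (τ.modAll (e : ℕ+)) f hf = C.modN (τ.mod e) f hf := by
  funext g
  exact τ.modAll_red_level e _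

/-- Hence at a level `e ∈ E` the mod-`e` theta cocycles for `modAll e` and for `τ.mod e` coincide.
[cite: MochizukiEtTh2009, Cor 2.19 (ii) p.64] -/
theorem thetaCocycles_modAll_level (hC : D.Compat) (e : Es) :
    C.thetaCocycles hC (τ.modAll (e : ℕ+)) = C.thetaCocycles hC (τ.mod e) := by
  ext η
  constructor
  · rintro ⟨f, hf, rfl⟩
    exact ⟨f, hf, C.modN_modAll_level τ e f hf.1⟩
  · rintro ⟨f, hf, rfl⟩
    exact ⟨f, hf, (C.modN_modAll_level τ e f hf.1).symm⟩

/-! ### Bookkeeping for consumers of L2-t8's chain-indexed tower `thetaEnvTower` (all `rfl`) -/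

/-- The level-`M` data of the chain-indexed tower IS `C.thetaEnvData (τ.mod M) hC hS` (definitional).
[cite: MochizukiEtTh2009, Cor 2.19 (ii) p.64] -/
theorem thetaEnvTower_level (hC : D.Compat) (hS : D.Sec2Hyps) (M : Es) :
    (C.thetaEnvTower τ hC hS).level M = C.thetaEnvData (τ.mod M) hC hS := rfl

/-- The reductions of the chain-indexed tower are the REAL power maps (definitional).
[cite: MochizukiEtTh2009, Def 2.13 (ii) p.48] -/
theorem thetaEnvTower_red (hC : D.Compat) (hS : D.Sec2Hyps) {M M' : Es} (h : (M : ℕ+) ∣ M') :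
    (C.thetaEnvTower τ hC hS).red M M' h = MuN.red p M M' (pnat_dvd h) := rfl

/-- `redEnv` of the chain-indexed tower on the `μ`-coordinate: the power map (definitional).
[cite: MochizukiEtTh2009, Def 2.13 (ii) p.48] -/
theorem thetaEnvTower_redEnv_left (hC : D.Compat) (hS : D.Sec2Hyps) {M M' : Es} (h : (M : ℕ+) ∣ M')
    (x : ((C.thetaEnvTower τ hC hS).level M').env) :
    ((C.thetaEnvTower τ hC hS).redEnv M M' h x).left = MuN.red p M M' (pnat_dvd h) x.left := rfl

/-- `redEnv` of the chain-indexed tower on the `Π^tp_Y`-coordinate: the identity (definitional).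
[cite: MochizukiEtTh2009, Def 2.13 (ii) p.48] -/
theorem thetaEnvTower_redEnv_right (hC : D.Compat) (hS : D.Sec2Hyps) {M M' : Es} (h : (M : ℕ+) ∣ M')
    (x : ((C.thetaEnvTower τ hC hS).level M').env) :
    ((C.thetaEnvTower τ hC hS).redEnv M M' h x).right = x.right := rfl

/-- `redEnv` of the chain-indexed tower IS `SemidirectProduct.map (power map) id` (definitional; the
compatibility proof is the tower's `red_chi`). [cite: MochizukiEtTh2009, Def 2.13 (ii) p.48] -/
theorem thetaEnvTower_redEnv_eq (hC : D.Compat) (hS : D.Sec2Hyps) {M M' : Es} (h : (M : ℕ+) ∣ M') :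
    (C.thetaEnvTower τ hC hS).redEnv M M' h =
      SemidirectProduct.map (MuN.red p M M' (pnat_dvd h)) (MonoidHom.id _) (fun g => by
        refine MonoidHom.ext fun a => ?_
        change (C.thetaEnvTower τ hC hS).red M M' h ((C.thetaEnvTower τ hC hS).chi M'
            ((C.thetaEnvTower τ hC hS).aug (g : (C.thetaEnvTower τ hC hS).PiX)) a) =
          (C.thetaEnvTower τ hC hS).chi M
            ((C.thetaEnvTower τ hC hS).aug (g : (C.thetaEnvTower τ hC hS).PiX))
            ((C.thetaEnvTower τ hC hS).red M M' h a)
        exact (C.thetaEnvTower τ hC hS).red_chi M M' h _ a) := rfl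

/-- The same tower re-chained through `modAll` over the original chain has the same level data up to
the identification on elements (`rechain_self_mod_red`); over ANY chain `E'` its level-`M` data are
`C.thetaEnvData (τ.modAll M) hC hS` (definitional). [cite: MochizukiEtTh2009, Cor 2.19 (ii) p.64] -/
theorem thetaEnvTower_rechain_level (hC : D.Compat) (hS : D.Sec2Hyps) {E' : Set ℕ+}
    (one_mem : (1 : ℕ+) ∈ E') (cofinal : ∀ n : ℕ+, ∃ M ∈ E', n ∣ M)
    (total : ∀ M ∈ E', ∀ M' ∈ E', M ∣ M' ∨ M' ∣ M) (M : E') :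
    (C.thetaEnvTower (τ.rechain one_mem cofinal total) hC hS).level M =
      C.thetaEnvData (τ.modAll M) hC hS := rfl

end EtaleThetaData.DoubleUnderline

end ThetaSetting

end Literature.AnabelianGeometry.EtaleTheta

end
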